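import Summits.Ventures.LatticeQCDFlow.Scoring.PlaquetteWeakCoupling
import Summits.Ventures.LatticeQCDFlow.Scoring.PlaquetteWeakCouplingSU
import HarnessLib

/-!
# The one-loop law of the exact two-dimensional string tension: `β σ_N(β) → N/2` (`U(N)`), `→ (N²−1)/(2N)` (`SU(N)`)

HONEST FRAMING: exact (Metropolis-corrected) sampling algorithms for lattice gauge theory;
figures of merit are autocorrelation/cost numbers at stated couplings and volumes; no
continuum-physics claim.

Venture `LatticeQCDFlow` (cell pub-lqcd), sub-topic `Scoring`; FANOUT row 5 (`s0-sun-a`), GEN-20.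
NEW WORK of the cell (placement rule).  In two dimensions the exact string tension (lattice units) of the `U(N)` /
`SU(N)` Wilson theory is `σ_N(β) = −log|P_N(β)|` with `P_N` the one-plaquette plaquette (GEN-18/19 area law).  From the
one-loop laws of the plaquette (GEN-20 `PlaquetteWeakCoupling`, `PlaquetteWeakCouplingSU`) and the squeeze
`1 − P ≤ −log P ≤ (1 − P)/P` (`0 < P ≤ 1`):

* `tendsto_mul_neg_log_of_tendsto_mul_one_sub` — the squeeze lemma: `β(1 − P(β)) → c`, `P(β) → 1` ⇒ `β(−log|P(β)|) → c`;
* **`tendsto_mul_neg_log_unitary_plaquette`** — `β · (−log|P_N(β)|) → N/2` for `U(N)`, every `N ≥ 1`;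
* **`tendsto_mul_neg_log_specialUnitary_plaquette`** — `β · (−log|P_N(β)|) → (N²−1)/(2N)` for `SU(N)`, every `N ≥ 1`:
  asymptotic freedom of the 2-d lattice string tension at one loop, `σ_N(β) ~ dim G/(2Nβ)`, exactly.

No `def`, nothing cited as a fact, 0 sorry.
-/

noncomputable section

open Real MeasureTheory Filter Topology
open Literature.MathematicalPhysics.QuantumFieldTheory (haarProbability)

namespace Summit.Ventures.LatticeQCDFlow.Scoring

/-- **Squeeze**: if `P(β) → 1` and `β(1 − P(β)) → c` as `β → ∞` then `β(−log|P(β)|) → c`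
(`1 − P ≤ −log P ≤ (1 − P)/P` for `0 < P`). -/
theorem tendsto_mul_neg_log_of_tendsto_mul_one_sub {P : ℝ → ℝ} {c : ℝ} (hP : Tendsto P atTop (𝓝 1))
    (h : Tendsto (fun β => β * (1 - P β)) atTop (𝓝 c)) :
    Tendsto (fun β => β * -Real.log |P β|) atTop (𝓝 c) := by
  have hpos : ∀ᶠ β in atTop, 0 < P β := hP.eventually (eventually_gt_nhds zero_lt_one)
  have hβ : ∀ᶠ β : ℝ in atTop, 0 ≤ β := eventually_ge_atTop 0
  -- upper bound `β(1 − P)/P → c`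
  have hup : Tendsto (fun β => β * (1 - P β) / P β) atTop (𝓝 c) := by
    have h' := h.div hP one_ne_zero
    rw [div_one] at h'
    exact h'
  refine tendsto_of_tendsto_of_tendsto_of_le_of_le' h hup ?_ ?_
  · filter_upwards [hpos, hβ] with β hPβ hβ0
    rw [abs_of_pos hPβ]
    have := Real.log_le_sub_one_of_pos hPβ
    exact mul_le_mul_of_nonneg_left (by linarith) hβ0
  · filter_upwards [hpos, hβ] with β hPβ hβ0
    rw [abs_of_pos hPβ, mul_div_assoc]
    refine mul_le_mul_of_nonneg_left ?_ hβ0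
    have h1 := Real.one_sub_inv_le_log_of_pos hPβ
    rw [le_div_iff₀ hPβ]
    have : (1 - (P β)⁻¹) * P β = P β - 1 := by field_simp
    nlinarith [mul_le_mul_of_nonneg_right h1 hPβ.le]

/-- **THE ONE-LOOP LAW OF THE 2-d `U(N)` STRING TENSION, EVERY `N ≥ 1`**: `β · (−log|P_N(β)|) → N/2`. -/
theorem tendsto_mul_neg_log_unitary_plaquette (N : ℕ) [NeZero N] :
    Tendsto (fun β : ℝ => β * -Real.log
      |(∫ u, ((u : Matrix.unitaryGroup (Fin N) ℂ) : Matrix (Fin N) (Fin N) ℂ).trace.re / N *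
          Real.exp (-(β * ((N : ℝ) - ((u : Matrix.unitaryGroup (Fin N) ℂ) : Matrix (Fin N) (Fin N) ℂ).trace.re)))
        ∂(haarProbability (Matrix.unitaryGroup (Fin N) ℂ)))
      / (∫ u, Real.exp (-(β * ((N : ℝ) - ((u : Matrix.unitaryGroup (Fin N) ℂ) : Matrix (Fin N) (Fin N) ℂ).trace.re)))
        ∂(haarProbability (Matrix.unitaryGroup (Fin N) ℂ)))|) atTop (𝓝 ((N : ℝ) / 2)) :=
  tendsto_mul_neg_log_of_tendsto_mul_one_sub (tendsto_unitary_plaquette_atTop N)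
    (tendsto_mul_one_sub_unitary_plaquette N)

/-- **THE ONE-LOOP LAW OF THE 2-d `SU(N)` STRING TENSION, EVERY `N ≥ 1`**: `β · (−log|P_N(β)|) → (N² − 1)/(2N)`
(`SU(2)`: `3/4`; `SU(3)`: `4/3`). -/
theorem tendsto_mul_neg_log_specialUnitary_plaquette (N : ℕ) [NeZero N] :
    Tendsto (fun β : ℝ => β * -Real.log
      |(∫ u, ((u : Matrix.specialUnitaryGroup (Fin N) ℂ) : Matrix (Fin N) (Fin N) ℂ).trace.re / N *
          Real.exp (-(β * ((N : ℝ) - ((u : Matrix.specialUnitaryGroup (Fin N) ℂ) : Matrix (Fin N) (Fin N) ℂ).trace.re)))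
        ∂(haarProbability (Matrix.specialUnitaryGroup (Fin N) ℂ)))
      / (∫ u, Real.exp (-(β * ((N : ℝ) - ((u : Matrix.specialUnitaryGroup (Fin N) ℂ) :
          Matrix (Fin N) (Fin N) ℂ).trace.re))) ∂(haarProbability (Matrix.specialUnitaryGroup (Fin N) ℂ)))|)
      atTop (𝓝 (((N : ℝ) ^ 2 - 1) / (2 * N))) :=
  tendsto_mul_neg_log_of_tendsto_mul_one_sub (tendsto_specialUnitary_plaquette_atTop N)
    (tendsto_mul_one_sub_specialUnitary_plaquette N)

end Summit.Ventures.LatticeQCDFlow.Scoring
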